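import Summits.CriticalPhenomena.PercolationContinuityZ3.Theorems.PercNearOneGluingNoHeavyLowerTailSahiE3LroLayers
import Mathlib.Order.Hom.Basic
import Mathlib.Tactic.Linarith
import Mathlib.Tactic.Ring
import Mathlib.Tactic.Positivity
import HarnessLib
import HarnessLib.Audit

/-!
# `NoHeavyLowerTail` (crux stmt-CriticalPhenomena-4575), Sahi programme P4 (Holley / monotone coupling):
# linear read-once slots, file 4 — transport of flow certificates along order isomorphisms; one-point patterns

Support file (cell `prim-l12`, seat P4, generation 11; `--supports stmt-CriticalPhenomena-4575`).  No named facts, no sorries;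
standard axioms; def-free.

Bookkeeping for the induction along a linear read-once formula (`…SahiE3LroOrStep`, `…SahiE3LroAndStep`): the steps produce
certificates on `Bool × Q`; `Fin.consOrderIso` identifies `Bool × (Fin n → Bool)` with `Fin (n+1) → Bool`, and THEOREM
`cert_transport` moves a flow certificate with exact deliveries (and THEOREM `harris_transport` Harris' inequality) along any
order isomorphism of finite patterns.  THEOREM `harris_subsingleton`: the one-point pattern satisfies Harris' inequality.
-/

namespace Summit.CriticalPhenomena.PercolationContinuityZ3.Theorems.SahiE3LroTransport

open Finset
open scoped BigOperators

variable {P : Type*} {P' : Type*}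

/-- A one-point (subsingleton) pattern satisfies Harris' inequality for any weight. [folklore] -/
theorem harris_subsingleton [Fintype P] [DecidableEq P] [Subsingleton P] (ν : P → ℝ) (S S' : Finset P) :
    (∑ t ∈ S, ν t) * (∑ t ∈ S', ν t) ≤ (∑ t, ν t) * ∑ t ∈ S ∩ S', ν t := by
  classical
  have hu : ∀ X : Finset P, X = ∅ ∨ X = univ := fun X => by
    rcases X.eq_empty_or_nonempty with h | ⟨x, hx⟩
    · exact Or.inl h
    · right; ext y; simp only [Finset.mem_univ, iff_true]; rwa [Subsingleton.elim y x]
  rcases hu S with rfl | rfl <;> rcases hu S' with rfl | rfl <;> simp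

/-- Pull-back of a finite set along an order isomorphism. [folklore] -/
theorem mem_pullback [Fintype P] [PartialOrder P] [PartialOrder P'] [DecidableEq P'] (e : P ≃o P') (S' : Finset P') (x : P) :
    x ∈ univ.filter (fun x => e x ∈ S') ↔ e x ∈ S' := by simp

/-- The pull-back of an up-set along an order isomorphism is an up-set. [folklore] -/
theorem isUpperSet_pullback [Fintype P] [PartialOrder P] [PartialOrder P'] [DecidableEq P'] (e : P ≃o P') {S' : Finset P'} (hS' : IsUpperSet (S' : Set P')) :
    IsUpperSet ((univ.filter (fun x => e x ∈ S') : Finset P) : Set P) := by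
  intro x y hxy hx
  simp only [Finset.coe_filter, Finset.mem_univ, true_and, Set.mem_setOf_eq] at hx ⊢
  exact hS' (e.monotone hxy) hx

/-- Sums over a set of `P'` are sums over its pull-back. [folklore] -/
theorem sum_pullback [Fintype P] [PartialOrder P] [PartialOrder P'] [DecidableEq P'] (e : P ≃o P') (S' : Finset P') (g : P' → ℝ) :
    ∑ y ∈ S', g y = ∑ x ∈ univ.filter (fun x => e x ∈ S'), g (e x) := by
  refine (Finset.sum_equiv e.toEquiv (fun x => ?_) (fun x _ => rfl)).symm
  simp

/-- Total sums transport along an equivalence. [folklore] -/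
theorem sum_univ_transport [Fintype P] [Fintype P'] (e : P ≃ P') (ν : P → ℝ) (ν' : P' → ℝ) (hν : ∀ y, ν' y = ν (e.symm y)) :
    ∑ y, ν' y = ∑ x, ν x := by
  refine Fintype.sum_equiv e.symm ν' ν fun y => hν y

/-- **Harris' inequality transports along an order isomorphism.** [folklore] -/
theorem harris_transport [Fintype P] [Fintype P'] [DecidableEq P] [DecidableEq P'] [PartialOrder P]
    [PartialOrder P'] (e : P ≃o P') {ν : P → ℝ} (ν' : P' → ℝ) (hν : ∀ y, ν' y = ν (e.symm y))
    (hH : ∀ S S' : Finset P, IsUpperSet (S : Set P) → IsUpperSet (S' : Set P) →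
      (∑ t ∈ S, ν t) * (∑ t ∈ S', ν t) ≤ (∑ t, ν t) * ∑ t ∈ S ∩ S', ν t)
    (S S' : Finset P') (hS : IsUpperSet (S : Set P')) (hS' : IsUpperSet (S' : Set P')) :
    (∑ t ∈ S, ν' t) * (∑ t ∈ S', ν' t) ≤ (∑ t, ν' t) * ∑ t ∈ S ∩ S', ν' t := by
  have hνe : ∀ x, ν' (e x) = ν x := fun x => by rw [hν, e.symm_apply_apply]
  rw [sum_pullback e S, sum_pullback e S', sum_pullback e (S ∩ S'), sum_univ_transport e.toEquiv ν ν' hν]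
  simp only [hνe]
  have hi : univ.filter (fun x => e x ∈ S ∩ S') = univ.filter (fun x => e x ∈ S) ∩ univ.filter (fun x => e x ∈ S') := by
    ext x; simp
  rw [hi]
  exact hH _ _ (isUpperSet_pullback e hS) (isUpperSet_pullback e hS')

/-- **Flow certificates (with exact deliveries) transport along an order isomorphism.**  If `(R, Fl)` is a certificate
for the slot `U` and the weight `ν` on `P`, and `e : P ≃o P'`, then `(R ∘ e⁻¹, Fl ∘ (e⁻¹ × e⁻¹))` is one for the slot
`{y | e⁻¹ y ∈ U}` and the weight `ν ∘ e⁻¹` on `P'`. [folklore] -/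
theorem cert_transport [Fintype P] [Fintype P'] [DecidableEq P] [DecidableEq P'] [PartialOrder P]
    [PartialOrder P'] (e : P ≃o P') {ν : P → ℝ} {U : Finset P} {R : P → ℝ} {Fl : P → P → ℝ}
    (hR0 : ∀ t ∈ U, 0 ≤ R t) (hF0 : ∀ t s, 0 ≤ Fl t s) (hFle : ∀ t s, Fl t s ≠ 0 → s ≤ t)
    (hcap : ∀ t ∈ U, R t + ∑ s ∈ Uᶜ, Fl t s ≤ (∑ r, ν r) * ((∑ r, ν r) + ∑ r ∈ Uᶜ, ν r) * ν t)
    (hK : ∀ s ∈ Uᶜ, ∑ t ∈ U, Fl t s = (∑ r, ν r) * (∑ r ∈ U, ν r) * ν s)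
    (hpair : ∀ S S' : Finset P, IsUpperSet (S : Set P) → IsUpperSet (S' : Set P) →
      (∑ r, ν r) * ((∑ t ∈ S, ν t) * (∑ t ∈ S' ∩ U, ν t) + (∑ t ∈ S', ν t) * (∑ t ∈ S ∩ U, ν t))
          - (∑ r ∈ U, ν r) * (∑ t ∈ S, ν t) * (∑ t ∈ S', ν t) ≤ ∑ t ∈ (S ∩ S') ∩ U, R t)
    (ν' : P' → ℝ) (hν : ∀ y, ν' y = ν (e.symm y)) (U' : Finset P') (hU : ∀ y, y ∈ U' ↔ e.symm y ∈ U) :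
    ∃ (R' : P' → ℝ) (Fl' : P' → P' → ℝ),
      (∀ t ∈ U', 0 ≤ R' t) ∧ (∀ t s, 0 ≤ Fl' t s) ∧ (∀ t s, Fl' t s ≠ 0 → s ≤ t) ∧
      (∀ t ∈ U', R' t + ∑ s ∈ U'ᶜ, Fl' t s ≤ (∑ r, ν' r) * ((∑ r, ν' r) + ∑ r ∈ U'ᶜ, ν' r) * ν' t) ∧
      (∀ s ∈ U'ᶜ, ∑ t ∈ U', Fl' t s = (∑ r, ν' r) * (∑ r ∈ U', ν' r) * ν' s) ∧
      (∀ S S' : Finset P', IsUpperSet (S : Set P') → IsUpperSet (S' : Set P') →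
        (∑ r, ν' r) * ((∑ t ∈ S, ν' t) * (∑ t ∈ S' ∩ U', ν' t) + (∑ t ∈ S', ν' t) * (∑ t ∈ S ∩ U', ν' t))
            - (∑ r ∈ U', ν' r) * (∑ t ∈ S, ν' t) * (∑ t ∈ S', ν' t) ≤ ∑ t ∈ (S ∩ S') ∩ U', R' t) := by
  have hνe : ∀ x, ν' (e x) = ν x := fun x => by rw [hν, e.symm_apply_apply]
  -- pull-backs of the basic sets
  have pU : univ.filter (fun x => e x ∈ U') = U := by ext x; simp [hU]
  have pUc : univ.filter (fun x => e x ∈ U'ᶜ) = Uᶜ := by ext x; simp [hU]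
  have eZ : ∑ y, ν' y = ∑ x, ν x := sum_univ_transport e.toEquiv ν ν' hν
  have eNU : ∑ y ∈ U', ν' y = ∑ x ∈ U, ν x := by rw [sum_pullback e, pU]; simp only [hνe]
  have eND : ∑ y ∈ U'ᶜ, ν' y = ∑ x ∈ Uᶜ, ν x := by rw [sum_pullback e, pUc]; simp only [hνe]
  refine ⟨fun y => R (e.symm y), fun y z => Fl (e.symm y) (e.symm z), ?_, ?_, ?_, ?_, ?_, ?_⟩
  · intro t ht; exact hR0 _ ((hU t).1 ht)
  · intro t s; exact hF0 _ _
  · intro t s h; exact e.symm.le_iff_le.1 (hFle _ _ h)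
  · intro t ht
    have h1 : ∑ s ∈ U'ᶜ, Fl (e.symm t) (e.symm s) = ∑ s ∈ Uᶜ, Fl (e.symm t) s := by
      rw [sum_pullback e, pUc]; simp only [e.symm_apply_apply]
    rw [h1, eZ, eND, hν]
    exact hcap _ ((hU t).1 ht)
  · intro s hs
    have h1 : ∑ t ∈ U', Fl (e.symm t) (e.symm s) = ∑ t ∈ U, Fl t (e.symm s) := by
      rw [sum_pullback e, pU]; simp only [e.symm_apply_apply]
    rw [h1, eZ, eNU, hν]
    exact hK _ (by simpa using (show e.symm s ∈ Uᶜ from Finset.mem_compl.2 fun h => (Finset.mem_compl.1 hs) ((hU s).2 h)))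
  · intro S S' hS hS'
    set T := univ.filter (fun x => e x ∈ S) with hT
    set T' := univ.filter (fun x => e x ∈ S') with hT'
    have uT : IsUpperSet (T : Set P) := isUpperSet_pullback e hS
    have uT' : IsUpperSet (T' : Set P) := isUpperSet_pullback e hS'
    have e1 : ∑ t ∈ S, ν' t = ∑ t ∈ T, ν t := by rw [sum_pullback e]; simp only [hνe]; rfl
    have e2 : ∑ t ∈ S', ν' t = ∑ t ∈ T', ν t := by rw [sum_pullback e]; simp only [hνe]; rfl
    have p3 : univ.filter (fun x => e x ∈ S' ∩ U') = T' ∩ U := by ext x; simp [hU, hT']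
    have p4 : univ.filter (fun x => e x ∈ S ∩ U') = T ∩ U := by ext x; simp [hU, hT]
    have p5 : univ.filter (fun x => e x ∈ (S ∩ S') ∩ U') = (T ∩ T') ∩ U := by ext x; simp [hU, hT, hT']
    have e3 : ∑ t ∈ S' ∩ U', ν' t = ∑ t ∈ T' ∩ U, ν t := by rw [sum_pullback e, p3]; simp only [hνe]
    have e4 : ∑ t ∈ S ∩ U', ν' t = ∑ t ∈ T ∩ U, ν t := by rw [sum_pullback e, p4]; simp only [hνe]
    have e5 : ∑ t ∈ (S ∩ S') ∩ U', R (e.symm t) = ∑ t ∈ (T ∩ T') ∩ U, R t := by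
      rw [sum_pullback e, p5]; simp only [e.symm_apply_apply]
    rw [eZ, eNU, e1, e2, e3, e4, e5]
    exact hpair T T' uT uT'

end Summit.CriticalPhenomena.PercolationContinuityZ3.Theorems.SahiE3LroTransport
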